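import Mathlib
import HarnessLib
import Literature.NumberTheory.DiophantineGeometry.IntegerGCDBoundDefs

/-!
# The g.c.d. of `aⁿ − 1` and `bⁿ − 1` — the point `x` and the double product (proofs)

Part of the reduction of `Literature.NumberTheory.DiophantineGeometry.BugeaudCorvajaZannier2003_thm1`
([BugeaudCorvajaZannier2003] Thm. 1) to the `p`-adic Subspace Theorem along Bombieri–Gubler,
proof of Thm. 7.4.10, pp. 219–220 [BombieriGubler2006], for the pairs `(u, v) = (aⁿ, bⁿ)`
(objects in `IntegerGCDBoundDefs.lean`, assembly in `IntegerGCDBoundProofs.lean`).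

Proved here, for `a, b ≥ 2`, `n ≥ 1` and B–G's point `x = xVec a b k h n` and forms
`formInf`, `formFin` (`S ⊇` the primes of `ab`):

* the two systems of forms are linearly independent (`linearIndependent_formInf`,
  `linearIndependent_formFin`);
* **the small forms** (B–G (7.12)–(7.13): `|L_{∞ i}(x)| = O(d uⁱ/v)`): here EXACTLY
  `L_{∞ i}(x) = c_i` (`formInf_inl_xVec`, from `d (u−1) uⁱ (v^h − 1)/(v−1) = c_i (v^h − 1)`);
* the height bound `‖x‖ = max |x_m| ≤ (a^k b^h)ⁿ` (B–G: `H(x) ≤ 4|v|^{h+k+1}`), `‖x‖ ≥ 1`, `x ≠ 0`;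
* `g · Σ_m f_m x_m = relPoly k h f (aⁿ, bⁿ)` (`eval_relPoly_xVec`);
* the product formula over `S` for `S`-units (`prod_padicNorm_eq_inv`: `∏_{p ∈ S} |m|_p = m⁻¹`
  when the primes of `m` lie in `S`) and `∏_{p ∈ S} |z|_p ≤ 1` for integers;
* (7.14) `∏_{p ∈ S} |x_{W i}|_p ≤ v^{-h}`, and `|x_{Y jr}| ∏_{p ∈ S} |x_{Y jr}|_p ≤ d`
  (B–G: "`∏_{ν ∈ S} |L_{νi}(x)|_ν ≤ d` for `i > k`");
* **the double product** (B–G (7.13)–(7.15), exact form, `double_product_le`):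
  `∏_m |L_{∞ m}(x)| · ∏_{p ∈ S} ∏_m |L_{p m}(x)|_p ≤ (∏_{i<k} c_i v^{-h}) · d^{(k+1)h}`.

## References

* [BombieriGubler2006] E. Bombieri, W. Gubler, *Heights in Diophantine Geometry*, New Mathematical
  Monographs 4, CUP 2006, Thm. 7.4.10 and its proof (pp. 218–220), Cor. 7.2.5.
* [BugeaudCorvajaZannier2003] Y. Bugeaud, P. Corvaja, U. Zannier, *An upper bound for the G.C.D.
  of `aⁿ − 1` and `bⁿ − 1`*, Math. Z. 243 (2003), 79–84, Thm. 1.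
* [CorvajaZannier2002] P. Corvaja, U. Zannier, *On the greatest prime factor of `(ab+1)(ac+1)`*,
  Proc. Amer. Math. Soc. 131 (2003), 1705–1709.
-/

namespace Literature.NumberTheory.DiophantineGeometry

namespace BugeaudCorvajaZannier2003

open Finset MvPolynomial

section Forms

variable (k h : ℕ)

/-- The coordinate forms are linearly independent. [folklore] -/
theorem linearIndependent_formFin (p : ℕ) : LinearIndependent ℚ (formFin k h p) := by
  classical
  have : formFin k h p = fun m => (Pi.basisFun ℚ (Fin k ⊕ (Fin (k + 1) × Fin h))) m := by
    funext m m'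
    simp [formFin, Pi.basisFun_apply, Pi.single_apply]
  rw [this]
  exact (Pi.basisFun ℚ _).linearIndependent

/-- The forms at `∞` are linearly independent (unitriangular with respect to the coordinate
forms). [cite: BombieriGubler2006, proof of Thm. 7.4.10] -/
theorem linearIndependent_formInf : LinearIndependent ℚ (formInf k h) := by
  classical
  rw [Fintype.linearIndependent_iff]
  intro g hg
  -- evaluate the vanishing combination at the coordinates
  have hev : ∀ m', ∑ m, g m * formInf k h m m' = 0 := fun m' => by
    have := congrFun hg m'
    simpa [Finset.sum_apply, Pi.smul_apply, smul_eq_mul] using this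
  -- at a `W`-coordinate only `L_{∞, W i}` contributes
  have hW : ∀ i : Fin k, g (Sum.inl i) = 0 := fun i => by
    have := hev (Sum.inl i)
    rw [Fintype.sum_sum_type] at this
    simpa [formInf, Finset.sum_ite_eq', mul_add, mul_sub] using this
  -- at a `Y`-coordinate, what is left is the coordinate form
  have hY : ∀ jr : Fin (k + 1) × Fin h, g (Sum.inr jr) = 0 := fun jr => by
    have := hev (Sum.inr jr)
    rw [Fintype.sum_sum_type] at this
    simpa [formInf, hW, Finset.sum_ite_eq'] using this
  intro m
  cases m with
  | inl i => exact hW i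
  | inr jr => exact hY jr

end Forms

/-! ### Values of the forms on `x`, height, non-vanishing -/

section Values

variable {a b : ℕ} (ha : 2 ≤ a) (hb : 2 ≤ b) (k h : ℕ) {n : ℕ} (hn : 1 ≤ n)

/-- Geometric sum: `(Σ_{r<h} v^{h-1-r}) (v − 1) = v^h − 1`. [folklore] -/
theorem geom_sum_reflect {K : Type*} [CommRing K] (v : K) (h : ℕ) :
    (∑ r : Fin h, v ^ (h - 1 - (r : ℕ))) * (v - 1) = v ^ h - 1 := by
  have h1 : ∑ r : Fin h, v ^ (h - 1 - (r : ℕ)) = ∑ s ∈ Finset.range h, v ^ s := by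
    rw [← Fin.sum_univ_eq_sum_range, ← Equiv.sum_comp Fin.revPerm]
    refine Finset.sum_congr rfl fun r _ => ?_
    congr 1
    simp [Fin.revPerm_apply, Fin.val_rev]
    omega
  rw [h1, geom_sum_mul]

include ha hb hn in
/-- **The small linear forms** (B–G (7.12)–(7.13)): `L_{∞, W i}(x) = c_i`, exactly:
`v^h c_i + d uⁱ Σ_r v^{h-1-r} − d u^{i+1} Σ_r v^{h-1-r} = c_i` because
`d (u − 1) uⁱ (v^h − 1)/(v − 1) = c_i (v^h − 1)`. [cite: BombieriGubler2006, proof of Thm. 7.4.10] -/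
theorem formInf_inl_xVec (i : Fin k) :
    ∑ j, formInf k h (Sum.inl i) j * (xVec a b k h n j : ℚ) = cCoef a b n i := by
  rw [formInf_inl_apply]
  have hg : (gcdPow a b n : ℚ) ≠ 0 := by exact_mod_cast (gcdPow_pos ha hn).ne'
  have hC : (cCoef a b n i : ℚ) * (gcdPow a b n : ℚ) =
      ((a : ℚ) ^ n) ^ (i : ℕ) * ((a : ℚ) ^ n - 1) := by
    rw [← pow_mul, mul_comm n]; exact cCoef_mul_gcdPow_cast (K := ℚ) ha (b := b) i
  have hD := dCoef_mul_gcdPow_cast (K := ℚ) hb (a := a) (n := n)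
  have hG := geom_sum_reflect ((b : ℚ) ^ n) h
  have xW : (xVec a b k h n (Sum.inl i) : ℚ) = ((b : ℚ) ^ n) ^ h * (cCoef a b n i : ℚ) := by
    simp only [xVec]
    push_cast
    ring
  have xY : ∀ (j : Fin (k + 1)) (r : Fin h), (xVec a b k h n (Sum.inr (j, r)) : ℚ) =
      (dCoef a b n : ℚ) * ((a : ℚ) ^ n) ^ (j : ℕ) * ((b : ℚ) ^ n) ^ (h - 1 - (r : ℕ)) := by
    intro j r
    simp only [xVec]
    push_cast
    ring
  simp only [xW, xY, Fin.val_castSucc, Fin.val_succ, ← Finset.mul_sum, pow_succ]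
  set G := ∑ r : Fin h, ((b : ℚ) ^ n) ^ (h - 1 - (r : ℕ)) with hGdef
  apply mul_left_cancel₀ hg
  linear_combination (((b : ℚ) ^ n) ^ h - 1) * hC +
    ((a : ℚ) ^ n) ^ (i : ℕ) * G * (1 - (a : ℚ) ^ n) * hD -
    ((a : ℚ) ^ n) ^ (i : ℕ) * ((a : ℚ) ^ n - 1) * hG

end Values

/-! ### Coordinates of `x` as rationals; height; non-vanishing; the relation polynomial -/

section Coordinates

variable {a b : ℕ} (ha : 2 ≤ a) (hb : 2 ≤ b) (k h : ℕ) {n : ℕ} (hn : 1 ≤ n)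

/-- `x_{W i} = v^h c_i` in `ℚ`. [cite: BombieriGubler2006, proof of Thm. 7.4.10] -/
theorem xVec_inl_cast (i : Fin k) :
    (xVec a b k h n (Sum.inl i) : ℚ) = ((b : ℚ) ^ n) ^ h * (cCoef a b n i : ℚ) := by
  simp only [xVec]
  push_cast
  ring

/-- `x_{Y j r} = d u^j v^{h-1-r}` in `ℚ`. [cite: BombieriGubler2006, proof of Thm. 7.4.10] -/
theorem xVec_inr_cast (jr : Fin (k + 1) × Fin h) :
    (xVec a b k h n (Sum.inr jr) : ℚ) =
      (dCoef a b n : ℚ) * ((a : ℚ) ^ n) ^ (jr.1 : ℕ) * ((b : ℚ) ^ n) ^ (h - 1 - (jr.2 : ℕ)) := by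
  simp only [xVec]
  push_cast
  ring

include ha hb in
/-- Height bound: every coordinate of `x` is at most `(a^k b^h)ⁿ` (B–G: `H(x) ≤ 4|v|^{h+k+1}`).
[cite: BombieriGubler2006, proof of Thm. 7.4.10] -/
theorem natAbs_xVec_le (hh : 1 ≤ h) (m : Fin k ⊕ (Fin (k + 1) × Fin h)) :
    (xVec a b k h n m).natAbs ≤ (a ^ k * b ^ h) ^ n := by
  have ha0 : 0 < a := by omega
  have hb0 : 0 < b := by omega
  rw [mul_pow, ← pow_mul, ← pow_mul]
  cases m with
  | inl i =>
    simp only [xVec, Int.natAbs_natCast]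
    have hc : cCoef a b n i ≤ a ^ (k * n) :=
      (cCoef_lt ha (b := b) (n := n) i).le.trans
        (Nat.pow_le_pow_right ha0 (Nat.mul_le_mul_right n (by omega)))
    calc b ^ (h * n) * cCoef a b n i ≤ b ^ (h * n) * a ^ (k * n) := Nat.mul_le_mul_left _ hc
      _ = a ^ (k * n) * b ^ (h * n) := mul_comm _ _
  | inr jr =>
    obtain ⟨j, r⟩ := jr
    simp only [xVec, Int.natAbs_natCast]
    have hd : dCoef a b n ≤ b ^ n := (dCoef_lt hb).le
    have hj : a ^ ((j : ℕ) * n) ≤ a ^ (k * n) :=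
      Nat.pow_le_pow_right ha0 (Nat.mul_le_mul_right n (by omega))
    have hr : b ^ ((h - 1 - (r : ℕ)) * n) ≤ b ^ ((h - 1) * n) :=
      Nat.pow_le_pow_right hb0 (Nat.mul_le_mul_right n (by omega))
    calc dCoef a b n * (a ^ ((j : ℕ) * n) * b ^ ((h - 1 - (r : ℕ)) * n))
        ≤ b ^ n * (a ^ (k * n) * b ^ ((h - 1) * n)) :=
          Nat.mul_le_mul hd (Nat.mul_le_mul hj hr)
      _ = a ^ (k * n) * b ^ (h * n) := by
          have : h * n = (h - 1) * n + n := by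
            obtain ⟨h', rfl⟩ := Nat.exists_eq_add_of_le' hh
            simp [add_mul]
          rw [this, pow_add]; ring

include ha hb in
/-- Height bound for the sup-norm: `‖x‖ ≤ (a^k b^h)ⁿ`. [cite: BombieriGubler2006, proof of Thm. 7.4.10] -/
theorem sup_natAbs_xVec_le (hh : 1 ≤ h) :
    (Finset.univ.sup fun m => (xVec a b k h n m).natAbs) ≤ (a ^ k * b ^ h) ^ n :=
  Finset.sup_le fun m _ => natAbs_xVec_le ha hb k h hh m

include hb hn in
/-- `‖x‖ ≥ 1`, indeed the coordinate `x_{Y 0 0} = d v^{h-1} ≥ 1`. [folklore] -/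
theorem one_le_sup_natAbs_xVec (hh : 1 ≤ h) :
    1 ≤ Finset.univ.sup fun m => (xVec a b k h n m).natAbs := by
  have hm : (1 : ℕ) ≤ (xVec a b k h n (Sum.inr (0, ⟨0, hh⟩))).natAbs := by
    simp only [xVec, Int.natAbs_natCast, Fin.val_zero, zero_mul, pow_zero, one_mul]
    exact Nat.mul_pos (dCoef_pos hb hn) (Nat.pow_pos (by omega))
  exact hm.trans (Finset.le_sup (f := fun m => (xVec a b k h n m).natAbs) (Finset.mem_univ _))

include hb hn in
/-- `x ≠ 0`. [folklore] -/
theorem xVec_ne_zero (hh : 1 ≤ h) : xVec a b k h n ≠ 0 := fun h0 => by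
  have h1 := one_le_sup_natAbs_xVec hb k h hn hh (a := a)
  rw [h0] at h1
  simp at h1

include ha hb in
/-- The link with the relation polynomial: `g · Σ_m f_m x_m = relPoly k h f (aⁿ, bⁿ)`
(B–G p. 220: substituting the `x_i` into `Σ a_i x_i = 0` gives `f(u)/(v−1) + g(u,v)/v^h = 0`).
[cite: BombieriGubler2006, proof of Thm. 7.4.10] -/
theorem eval_relPoly_xVec (f : Fin k ⊕ (Fin (k + 1) × Fin h) → ℚ) :
    MvPolynomial.eval ![(a : ℚ) ^ n, (b : ℚ) ^ n] (relPoly k h f) =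
      (gcdPow a b n : ℚ) * ∑ j, f j * (xVec a b k h n j : ℚ) := by
  have hC : ∀ i : ℕ, (cCoef a b n i : ℚ) * (gcdPow a b n : ℚ) =
      ((a : ℚ) ^ n) ^ i * ((a : ℚ) ^ n - 1) := fun i => by
    rw [← pow_mul, mul_comm n]; exact cCoef_mul_gcdPow_cast (K := ℚ) ha (b := b) i
  have hD := dCoef_mul_gcdPow_cast (K := ℚ) hb (a := a) (n := n)
  rw [eval_relPoly, Fintype.sum_sum_type, mul_add, Finset.mul_sum, Finset.mul_sum,
    Finset.mul_sum, Finset.mul_sum]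
  congr 1
  · refine Finset.sum_congr rfl fun i _ => ?_
    rw [xVec_inl_cast]
    linear_combination (-(f (Sum.inl i) * ((b : ℚ) ^ n) ^ h)) * hC i
  · refine Finset.sum_congr rfl fun jr _ => ?_
    rw [xVec_inr_cast]
    linear_combination
      (-(f (Sum.inr jr) * ((a : ℚ) ^ n) ^ (jr.1 : ℕ) * ((b : ℚ) ^ n) ^ (h - 1 - (jr.2 : ℕ)))) * hD

end Coordinates

/-! ### `p`-adic absolute values: the product over the finite places -/

section Padic

variable (S : Finset ℕ) (hS : ∀ p ∈ S, p.Prime)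

include hS in
/-- `∏_{p ∈ S} |z|_p ≤ 1` for an integer `z`. [folklore] -/
theorem prod_padicNorm_int_le_one (z : ℤ) : ∏ p ∈ S, padicNorm p z ≤ 1 :=
  Finset.prod_le_one (fun p _ => padicNorm.nonneg _) fun p hp => by
    haveI := Fact.mk (hS p hp); exact padicNorm.of_int z

include hS in
/-- Product formula over `S`: if all prime factors of `m ≥ 1` lie in `S` then
`∏_{p ∈ S} |m|_p = m⁻¹`. [folklore] -/
theorem prod_padicNorm_eq_inv {m : ℕ} (hm : m ≠ 0) (hsub : m.primeFactors ⊆ S) :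
    ∏ p ∈ S, padicNorm p m = ((m : ℚ))⁻¹ := by
  have h1 : ∀ p ∈ S, padicNorm p m = ((p : ℚ) ^ m.factorization p)⁻¹ := by
    intro p hp
    haveI := Fact.mk (hS p hp)
    rw [padicNorm.eq_zpow_of_nonzero (by exact_mod_cast hm), padicValRat.of_nat, zpow_neg,
      zpow_natCast, Nat.factorization_def _ (hS p hp)]
  rw [Finset.prod_congr rfl h1, Finset.prod_inv_distrib]
  congr 1
  rw [← Finset.prod_subset hsub (fun p _ hpm => ?_)]
  · exact_mod_cast (Nat.prod_primeFactors_pow_factorization hm).symm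
  · have : m.factorization p = 0 :=
      Finsupp.notMem_support_iff.mp (by rwa [Nat.support_factorization])
    simp [this]

/-- The prime factors of a power lie among those of the base. [folklore] -/
theorem primeFactors_pow_subset (c e : ℕ) : (c ^ e).primeFactors ⊆ c.primeFactors := by
  rcases Nat.eq_zero_or_pos e with rfl | he
  · simp
  · rw [Nat.primeFactors_pow c he.ne']

include hS in
/-- `∏_{p ∈ S} |cᵉ|_p = c⁻ᵉ` when the prime factors of `c ≥ 1` lie in `S` (an `S`-unit).
[folklore] -/
theorem prod_padicNorm_pow_eq_inv {c : ℕ} (hc : c ≠ 0) (hsub : c.primeFactors ⊆ S) (e : ℕ) :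
    ∏ p ∈ S, padicNorm p ((c : ℚ) ^ e) = ((c : ℚ) ^ e)⁻¹ := by
  have := prod_padicNorm_eq_inv S hS (m := c ^ e) (pow_ne_zero _ hc)
    ((primeFactors_pow_subset c e).trans hsub)
  push_cast at this
  exact this

include hS in
/-- Multiplicativity of `∏_{p ∈ S} |·|_p`. [folklore] -/
theorem prod_padicNorm_mul (q r : ℚ) :
    ∏ p ∈ S, padicNorm p (q * r) = (∏ p ∈ S, padicNorm p q) * ∏ p ∈ S, padicNorm p r := by
  rw [← Finset.prod_mul_distrib]
  refine Finset.prod_congr rfl fun p hp => ?_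
  haveI := Fact.mk (hS p hp)
  exact padicNorm.mul q r

end Padic

/-! ### The double product of B–G (7.13)–(7.15) -/

section Product

variable {a b : ℕ} (ha : 2 ≤ a) (hb : 2 ≤ b) (k h : ℕ) {n : ℕ} (hn : 1 ≤ n)
variable (S : Finset ℕ) (hS : ∀ p ∈ S, p.Prime) (haS : a.primeFactors ⊆ S)
  (hbS : b.primeFactors ⊆ S)

include hS hb hbS in
/-- (7.14): `∏_{p ∈ S} |x_{W i}|_p ≤ v^{-h}` (`x_{W i} = v^h c_i ∈ v^h ℤ`).
[cite: BombieriGubler2006, proof of Thm. 7.4.10] -/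
theorem prod_padicNorm_xVec_inl_le (i : Fin k) :
    ∏ p ∈ S, padicNorm p (xVec a b k h n (Sum.inl i) : ℚ) ≤ (((b : ℚ) ^ n) ^ h)⁻¹ := by
  rw [xVec_inl_cast, prod_padicNorm_mul S hS, ← pow_mul,
    prod_padicNorm_pow_eq_inv S hS (by omega) hbS]
  have h0 : 0 ≤ (((b : ℚ) ^ (n * h)))⁻¹ := by positivity
  calc ((b : ℚ) ^ (n * h))⁻¹ * ∏ p ∈ S, padicNorm p (cCoef a b n i : ℚ)
      ≤ ((b : ℚ) ^ (n * h))⁻¹ * 1 := by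
        refine mul_le_mul_of_nonneg_left ?_ h0
        exact_mod_cast prod_padicNorm_int_le_one S hS (cCoef a b n i)
    _ = ((b : ℚ) ^ (n * h))⁻¹ := by rw [mul_one]

include hS ha hb haS hbS in
/-- `|x_{Y j r}| · ∏_{p ∈ S} |x_{Y j r}|_p ≤ d` (`x_{Y j r}` is `d` times an `S`-unit; B–G:
"`∏_{ν ∈ S} |L_{νi}(x)|_ν ≤ d` for `i > k`"). [cite: BombieriGubler2006, proof of Thm. 7.4.10] -/
theorem mul_prod_padicNorm_xVec_inr_le (jr : Fin (k + 1) × Fin h) :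
    |(xVec a b k h n (Sum.inr jr) : ℚ)| * ∏ p ∈ S, padicNorm p (xVec a b k h n (Sum.inr jr) : ℚ) ≤
      dCoef a b n := by
  have ha0 : (a : ℚ) ≠ 0 := by exact_mod_cast (show a ≠ 0 by omega)
  have hb0 : (b : ℚ) ≠ 0 := by exact_mod_cast (show b ≠ 0 by omega)
  rw [xVec_inr_cast, prod_padicNorm_mul S hS, prod_padicNorm_mul S hS, ← pow_mul, ← pow_mul,
    prod_padicNorm_pow_eq_inv S hS (by omega) haS, prod_padicNorm_pow_eq_inv S hS (by omega) hbS,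
    abs_of_nonneg (by positivity)]
  have hd1 : ∏ p ∈ S, padicNorm p (dCoef a b n : ℚ) ≤ 1 := by
    exact_mod_cast prod_padicNorm_int_le_one S hS (dCoef a b n)
  have hd0 : 0 ≤ ∏ p ∈ S, padicNorm p (dCoef a b n : ℚ) :=
    Finset.prod_nonneg fun p _ => padicNorm.nonneg _
  calc (dCoef a b n : ℚ) * (a : ℚ) ^ (n * (jr.1 : ℕ)) * (b : ℚ) ^ (n * (h - 1 - (jr.2 : ℕ))) *
        ((∏ p ∈ S, padicNorm p (dCoef a b n : ℚ)) * ((a : ℚ) ^ (n * (jr.1 : ℕ)))⁻¹ *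
          ((b : ℚ) ^ (n * (h - 1 - (jr.2 : ℕ))))⁻¹)
      = (dCoef a b n : ℚ) * ∏ p ∈ S, padicNorm p (dCoef a b n : ℚ) := by
        field_simp
    _ ≤ (dCoef a b n : ℚ) * 1 := mul_le_mul_of_nonneg_left hd1 (by positivity)
    _ = dCoef a b n := mul_one _

include hS ha hb hn haS hbS in
/-- **The double product** (B–G (7.13)–(7.15), exact form):
`∏_{v ∈ S} ∏_m |L_{v m}(x)|_v ≤ (∏_{i<k} c_i v^{-h}) · d^{(k+1)h}`.
[cite: BombieriGubler2006, proof of Thm. 7.4.10] -/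
theorem double_product_le :
    (∏ m, |∑ j, formInf k h m j * (xVec a b k h n j : ℚ)|) *
        ∏ p ∈ S, ∏ m, padicNorm p (∑ j, formFin k h p m j * (xVec a b k h n j : ℚ)) ≤
      (∏ i : Fin k, (cCoef a b n i : ℚ) * (((b : ℚ) ^ n) ^ h)⁻¹) *
        (dCoef a b n : ℚ) ^ ((k + 1) * h) := by
  -- evaluate the forms
  have e1 : ∀ p, ∀ m, padicNorm p (∑ j, formFin k h p m j * (xVec a b k h n j : ℚ)) =
      padicNorm p (xVec a b k h n m : ℚ) := fun p m => by rw [formFin_apply]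
  simp only [e1]
  set P : Fin k → ℚ := fun i => ∏ p ∈ S, padicNorm p (xVec a b k h n (Sum.inl i) : ℚ) with hP
  set Q : Fin (k + 1) × Fin h → ℚ := fun jr =>
    ∏ p ∈ S, padicNorm p (xVec a b k h n (Sum.inr jr) : ℚ) with hQ
  -- regroup the left-hand side as `(∏_i c_i P_i) · (∏_jr |x_jr| Q_jr)`
  have lhs_eq : (∏ m, |∑ j, formInf k h m j * (xVec a b k h n j : ℚ)|) *
        ∏ p ∈ S, ∏ m, padicNorm p (xVec a b k h n m : ℚ) =
      (∏ i : Fin k, (cCoef a b n i : ℚ) * P i) *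
        ∏ jr : Fin (k + 1) × Fin h, |(xVec a b k h n (Sum.inr jr) : ℚ)| * Q jr := by
    rw [Finset.prod_comm, Fintype.prod_sum_type, Fintype.prod_sum_type]
    simp only [formInf_inl_xVec ha hb k h hn, formInf_inr_apply, Nat.abs_cast, hP, hQ,
      Finset.prod_mul_distrib]
    ring
  have rhs_eq : (∏ i : Fin k, (cCoef a b n i : ℚ) * (((b : ℚ) ^ n) ^ h)⁻¹) *
        (dCoef a b n : ℚ) ^ ((k + 1) * h) =
      (∏ i : Fin k, (cCoef a b n i : ℚ) * (((b : ℚ) ^ n) ^ h)⁻¹) *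
        ∏ _jr : Fin (k + 1) × Fin h, (dCoef a b n : ℚ) := by
    rw [Finset.prod_const, Finset.card_univ, Fintype.card_prod, Fintype.card_fin, Fintype.card_fin]
  rw [lhs_eq, rhs_eq]
  refine mul_le_mul ?_ ?_ (Finset.prod_nonneg fun jr _ => mul_nonneg (abs_nonneg _)
    (Finset.prod_nonneg fun p _ => padicNorm.nonneg _))
    (Finset.prod_nonneg fun i _ => mul_nonneg (by positivity) (by positivity))
  · refine Finset.prod_le_prod (fun i _ => mul_nonneg (by positivity)
      (Finset.prod_nonneg fun p _ => padicNorm.nonneg _)) fun i _ => ?_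
    exact mul_le_mul_of_nonneg_left (prod_padicNorm_xVec_inl_le hb k h S hS hbS i) (by positivity)
  · exact Finset.prod_le_prod (fun jr _ => mul_nonneg (abs_nonneg _)
      (Finset.prod_nonneg fun p _ => padicNorm.nonneg _))
      fun jr _ => mul_prod_padicNorm_xVec_inr_le ha hb k h S hS haS hbS jr

end Product

end BugeaudCorvajaZannier2003

end Literature.NumberTheory.DiophantineGeometry
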